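import Summits.HubbardSuperconductivity.HubbardSuperconductivity.Theses.BalabanIR

/-!
# Route `BalabanIR`, crux 5 `BirEveryGroundState` (`stmt-HubbardSuperconductivity-2083`):
# the propositional position of the crux in the route

Pure logic about the two `X`-items of the route, `BirGroundStateAverageLRO` (target, item
`stmt-HubbardSuperconductivity-2079`: GS-AVERAGE `d`-wave pair LRO on a window of couplings) and
`BirEveryGroundState` (crux 5, item `stmt-HubbardSuperconductivity-2083`: average on a window ⇒
EVERY ground state at some coupling of the window). The hypothesis of crux 5 is, verbatim, the body
of the target at the datum `(δ, U₁, U₂, c)`; hence: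

* `birEveryGroundState_of_not_birGroundStateAverageLRO` — if the target is FALSE the crux is
  (vacuously) TRUE; contrapositively `birGroundStateAverageLRO_of_not_birEveryGroundState` — any
  REFUTATION of crux 5 is a PROOF of the route's target (on the refuting window). In particular
  `birEveryGroundState_or_birGroundStateAverageLRO`: the two `X`-items are never both false, and
  crux 5 cannot be refuted before the target is proved (the "insulation" recorded in prose in
  `Cruxes/BirEveryGroundState/Disproof.lean`, here as theorems).
* `birEveryGroundState_iff_exists_imp` — the DRINKER NORMAL FORM of the crux: since a window is
  non-empty, `(∀ U ∈ W, Avg U) → ∃ U ∈ W, Every U` is the same as `∃ U ∈ W, (Avg U → Every U)`.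
  So crux 5 says exactly: for every doping `δ ∈ (0,1/2)` and constant `c > 0`, the set of
  repulsive couplings `U` at which the POINTWISE transfer "eventual average bound `c L⁴` on the
  sector ground eigenspaces at `U` ⇒ every normalised sector ground-state sequence at `U` has
  `d`-wave pair LRO" holds meets every window — `birEveryGroundState_iff_dense`: that set (padded
  by `U ≤ 0`) is DENSE in `ℝ`. This is the window-free, honest reading of "average ⇒ every at
  generic `U`": no uniformity in `U`, no analytic continuation across couplings is asked or given;
  the crux is a pointwise genericity statement about doped repulsive Hubbard tori, one coupling
  at a time, on a dense set.

All statements spell out the route bodies verbatim (no definition is introduced); this module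
imports the route file to NAME the two decls and is therefore a `--supports` helper that no
closing module may import (materialisation rule, route rev 5). Folklore (classical propositional
logic; Smullyan's drinker principle); `Dense`/`Metric.ball` API from Mathlib.
-/

namespace Summit.HubbardSuperconductivity.HubbardSuperconductivity.Theorems

open Literature.Probability.LatticeModels Literature.MathematicalPhysics.QuantumLattice
open Summit.HubbardSuperconductivity.HubbardSuperconductivity.Theses.BalabanIR

/-- **If the target is false, crux 5 is true** (its hypothesis is an instance of the target's
body, so it can never be met). [folklore] -/
theorem birEveryGroundState_of_not_birGroundStateAverageLRO (hX : ¬ BirGroundStateAverageLRO) :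
    BirEveryGroundState :=
  fun δ U₁ U₂ c hδ hU₁ hU₁₂ hc havg => absurd ⟨δ, hδ, U₁, U₂, c, hU₁, hU₁₂, hc, havg⟩ hX

/-- **A refutation of crux 5 is a proof of the target**: `¬ BirEveryGroundState` exhibits a
datum `(δ, U₁, U₂, c)` at which the window-average hypothesis HOLDS — which is the body of
`BirGroundStateAverageLRO` — (and at which no coupling of the window has every-ground-state LRO).
[folklore] -/
theorem birGroundStateAverageLRO_of_not_birEveryGroundState (h : ¬ BirEveryGroundState) :
    BirGroundStateAverageLRO := by
  by_contra hX
  exact h (birEveryGroundState_of_not_birGroundStateAverageLRO hX)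

/-- **The two `X`-items of the route are never both false**: `BirEveryGroundState ∨
BirGroundStateAverageLRO` is a theorem (so the pair is not jointly refutable, and every refuter of
crux 5 owes a proof of ground-state-average `d`-wave pair LRO on a window). [folklore] -/
theorem birEveryGroundState_or_birGroundStateAverageLRO :
    BirEveryGroundState ∨ BirGroundStateAverageLRO := by
  by_cases hX : BirGroundStateAverageLRO
  · exact Or.inr hX
  · exact Or.inl (birEveryGroundState_of_not_birGroundStateAverageLRO hX)

/-- **Drinker normal form of crux 5.** `BirEveryGroundState` holds iff for all `δ ∈ (0,1/2)`,
`0 < U₁ < U₂`, `c > 0` there is a coupling `U ∈ (U₁, U₂)` at which the POINTWISE transfer holds: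
IF eventually in even `L` the sector ground eigenspaces of `hubbardTorus 2 L 1 U` carry the average
bound `c L⁴ re tr P ≤ re tr (P Δ_d†Δ_d)`, THEN every admissible normalised sector ground-state
sequence at `U` has `d_{x²-y²}` pair-field LRO along the even sides. (`(∀ U ∈ W, A U) → ∃ U ∈ W, E U`
versus `∃ U ∈ W, (A U → E U)`: ⇐ is trivial; ⇒ by cases on whether `A` fails somewhere in `W`.)
[folklore] -/
theorem birEveryGroundState_iff_exists_imp : BirEveryGroundState ↔ ∀ (δ U₁ U₂ c : ℝ), δ ∈ Set.Ioo (0:ℝ) (1/2) → 0 < U₁ → U₁ < U₂ → 0 < c → ∃ U ∈ Set.Ioo U₁ U₂, ((∃ L₀ : ℕ, ∀ (L : ℕ) [NeZero L], L₀ ≤ L → Even L → let N : ℕ := 2 * ⌊(1 - δ) * (L : ℝ) ^ 2 / 2⌋₊; let H := hubbardTorus 2 L 1 U; let S := szSector (Λ := FermionTorus 2 L) N 0; let E₀ := S ⊓ Module.End.eigenspace (Matrix.toLin' H) ((H.minEnergyOn S : ℝ) : ℂ); let P := projMatrix (E₀.map (Fock.toEuclidean (ι := Orb (FermionTorus 2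 L)) : Fock (Orb (FermionTorus 2 L)) →ₗ[ℂ] EuclideanSpace ℂ (Finset (Orb (FermionTorus 2 L))))); c * (L : ℝ) ^ 4 * P.trace.re ≤ (P * (Matrix.conjTranspose (pairField dWaveFormFactor L) * pairField dWaveFormFactor L)).trace.re) → ∀ (N : ℕ → ℕ) (ψ : ∀ L, Fock (Orb (FermionTorus 2 L))), (∀ L, Even L → N L = 2 * ⌊(1 - δ) * (L : ℝ) ^ 2 / 2⌋₊ ∧ star (ψ L) ⬝ᵥ ψ L = 1 ∧ IsGroundStateInSector (hubbardTorus 2 L 1 U) (N L) 0 (ψ L)) → HasLongRangeOrder (fun k => halfOpenBox 2 (2 * k)) (fun k => torusPullback (pairFieldCorr dWaveFormFactor ψ) (2 * k))) := by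
  constructor
  · intro h δ U₁ U₂ c hδ hU₁ hU₁₂ hc
    by_contra hne
    have havg : ∀ U ∈ Set.Ioo U₁ U₂, (∃ L₀ : ℕ, ∀ (L : ℕ) [NeZero L], L₀ ≤ L → Even L → let N : ℕ := 2 * ⌊(1 - δ) * (L : ℝ) ^ 2 / 2⌋₊;
          let H := hubbardTorus 2 L 1 U;
          let S := szSector (Λ := FermionTorus 2 L) N 0;
          let E₀ := S ⊓ Module.End.eigenspace (Matrix.toLin' H) ((H.minEnergyOn S : ℝ) : ℂ);
          let P := projMatrix (E₀.map (Fock.toEuclidean (ι := Orb (FermionTorus 2 L)) : Fock (Orb (FermionTorus 2 L)) →ₗ[ℂ] EuclideanSpace ℂ (Finset (Orb (FermionTorus 2 L))))); c * (L : ℝ) ^ 4 * P.trace.re ≤ (P * (Matrix.conjTranspose (pairField dWaveFormFactor L) * pairField dWaveFormFactor L)).trace.re) := by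
      intro U hU
      by_contra hA
      exact hne ⟨U, hU, fun hA' => absurd hA' hA⟩
    obtain ⟨U, hU, hE⟩ := h δ U₁ U₂ c hδ hU₁ hU₁₂ hc havg
    exact hne ⟨U, hU, fun _ => hE⟩
  · intro h δ U₁ U₂ c hδ hU₁ hU₁₂ hc havg
    obtain ⟨U, hU, himp⟩ := h δ U₁ U₂ c hδ hU₁ hU₁₂ hc
    exact ⟨U, hU, himp (havg U hU)⟩

/-- **Density form of crux 5.** `BirEveryGroundState` holds iff for every `δ ∈ (0,1/2)` and
`c > 0` the set of real `U` such that `0 < U` implies the pointwise transfer at `U` (eventual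
average bound `c L⁴` on the sector ground eigenspaces ⇒ every-ground-state `d`-wave pair LRO at
`U`) is dense in `ℝ` — i.e. the pointwise transfer holds on a dense set of repulsive couplings.
(⇒: a non-empty open set contains a ball; its non-positive points belong to the set trivially, and
otherwise a window inside the ball yields a point by the drinker normal form; ⇐: a window is a
non-empty open set.) [folklore] -/
theorem birEveryGroundState_iff_dense :
    BirEveryGroundState ↔
      ∀ (δ c : ℝ), δ ∈ Set.Ioo (0:ℝ) (1/2) → 0 < c →
        Dense {U : ℝ | 0 < U →
          (∃ L₀ : ℕ, ∀ (L : ℕ) [NeZero L], L₀ ≤ L → Even L → let N : ℕ := 2 * ⌊(1 - δ) * (L : ℝ) ^ 2 / 2⌋₊;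
          let H := hubbardTorus 2 L 1 U;
          let S := szSector (Λ := FermionTorus 2 L) N 0;
          let E₀ := S ⊓ Module.End.eigenspace (Matrix.toLin' H) ((H.minEnergyOn S : ℝ) : ℂ);
          let P := projMatrix (E₀.map (Fock.toEuclidean (ι := Orb (FermionTorus 2 L)) : Fock (Orb (FermionTorus 2 L)) →ₗ[ℂ] EuclideanSpace ℂ (Finset (Orb (FermionTorus 2 L))))); c * (L : ℝ) ^ 4 * P.trace.re ≤ (P * (Matrix.conjTranspose (pairField dWaveFormFactor L) * pairField dWaveFormFactor L)).trace.re) →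
          ∀ (N : ℕ → ℕ) (ψ : ∀ L, Fock (Orb (FermionTorus 2 L))), (∀ L, Even L → N L = 2 * ⌊(1 - δ) * (L : ℝ) ^ 2 / 2⌋₊ ∧ star (ψ L) ⬝ᵥ ψ L = 1 ∧ IsGroundStateInSector (hubbardTorus 2 L 1 U) (N L) 0 (ψ L)) → HasLongRangeOrder (fun k => halfOpenBox 2 (2 * k)) (fun k => torusPullback (pairFieldCorr dWaveFormFactor ψ) (2 * k))} := by
  rw [birEveryGroundState_iff_exists_imp]
  constructor
  · intro h δ c hδ hc
    rw [dense_iff_inter_open]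
    intro O hO ⟨x, hx⟩
    obtain ⟨ε, hε, hball⟩ := Metric.isOpen_iff.mp hO x hx
    by_cases hx0 : x ≤ 0
    · exact ⟨x, hx, fun hpos => absurd hpos (not_lt.mpr hx0)⟩
    · push Not at hx0
      -- the window `(max (x - ε/2) (x/2), x + ε/2)` lies in the ball and in `(0, ∞)`
      have hU₁ : 0 < max (x - ε / 2) (x / 2) := lt_max_of_lt_right (by linarith)
      have hU₁₂ : max (x - ε / 2) (x / 2) < x + ε / 2 := max_lt (by linarith) (by linarith)
      obtain ⟨U, hU, himp⟩ := h δ (max (x - ε / 2) (x / 2)) (x + ε / 2) c hδ hU₁ hU₁₂ hc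
      refine ⟨U, hball ?_, fun _ => himp⟩
      rw [Metric.mem_ball, Real.dist_eq, abs_lt]
      constructor
      · have : x - ε / 2 < U := lt_of_le_of_lt (le_max_left _ _) hU.1
        linarith
      · linarith [hU.2]
  · intro h δ U₁ U₂ c hδ hU₁ hU₁₂ hc
    have hd := h δ c hδ hc
    rw [dense_iff_inter_open] at hd
    obtain ⟨U, hUO, hUs⟩ := hd (Set.Ioo U₁ U₂) isOpen_Ioo (Set.nonempty_Ioo.mpr hU₁₂)
    exact ⟨U, hUO, hUs (lt_trans hU₁ hUO.1)⟩

end Summit.HubbardSuperconductivity.HubbardSuperconductivity.Theorems
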